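import Summits.ValiantsHypothesis.ValiantsHypothesis.Theorems.DepthWindowSparseTwoLevel
import Mathlib.RingTheory.MvPolynomial.WeightedHomogeneous
import HarnessLib

/-!
# Route `DepthWindow`, g8 — jump-matrix entries as uniform products (leaf algebra for the builder)

Leaf algebra for piece (iv) of the `(2,3)` SLIVER LEMMA (lens-4 NODE-v8 §11): to feed the
two-level jump formula (`weightedHomogeneousComponent_prod_eq_twoLevel_fix`) into the generic gate
builder `exists_append_sumProdSumProdMul` (uniform inner fan-in), every matrix entry occurring in a
path weight must be ONE product of a fixed number of factors.  Here each entry of the jump matrix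
`jumpMat w d t U`, of the identity layers of `padLayers`, and of the terminal vector `finVec`, is
written as a product over `Fin (t+1)` of explicit factors, each a weight component `[U_l]_ε` or a
constant `0`/`1` (slot `t` carries the validity indicator, so that an invalid transition is the
product `… · 0` even when `t = 0`):

* `jumpMat_eq_prod_jumpFactor`, `one_apply_eq_prod_idFactor`, `padLayers_jumpMat_apply_eq_prod`,
  `finVec_eq_prod_finFactor`;
* every factor is weighted homogeneous (`jumpFactor_isWeightedHomogeneous`, …).

Pure algebra; nothing here bears on `VP ≠ VNP`.

[cite: LimayeSrinivasanTavenas2025, Lemma 11] [cite: Burgisser2000, Def. 2.1]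
-/

set_option linter.dupNamespace false

namespace Summit.ValiantsHypothesis.ValiantsHypothesis.Theorems.DepthWindow

open Finset MvPolynomial

variable {σ R : Type*} [CommRing R]

/-- Factor `l` (of `t+1`) of the jump-matrix entry `x → y`: `[U_l]_0` for the layers passed at
weight `0`, `[U_l]_{y₁-x₁}` for the jump layer `l = y₂ - 1`, the validity indicator in slot `t`,
and `1` elsewhere. -/
noncomputable def jumpFactor (w : σ → ℕ) (d t : ℕ) (U : ℕ → MvPolynomial σ R)
    (x y : Fin (d + 1) × Fin (t + 1)) (l : Fin (t + 1)) : MvPolynomial σ R :=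
  if (l : ℕ) = t then (if (x.2 : ℕ) < y.2 ∧ (x.1 : ℕ) < y.1 then 1 else 0)
  else if (x.2 : ℕ) ≤ l ∧ (l : ℕ) + 1 < y.2 then weightedHomogeneousComponent w 0 (U l)
  else if (l : ℕ) + 1 = y.2 then weightedHomogeneousComponent w ((y.1 : ℕ) - x.1) (U l)
  else 1

/-- Factor `l` of an identity-layer entry: the indicator `[x = y]` in slot `t`, `1` elsewhere. -/
noncomputable def idFactor (d t : ℕ) (x y : Fin (d + 1) × Fin (t + 1)) (l : Fin (t + 1)) :
    MvPolynomial σ R :=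
  if (l : ℕ) = t then (if x = y then 1 else 0) else 1

/-- Factor `l` of the terminal vector entry at `y`: `[y₁ = e]` in slot `t`, `[U_l]_0` for
`l ≥ y₂`, `1` elsewhere. -/
noncomputable def finFactor (w : σ → ℕ) (d t e : ℕ) (U : ℕ → MvPolynomial σ R)
    (y : Fin (d + 1) × Fin (t + 1)) (l : Fin (t + 1)) : MvPolynomial σ R :=
  if (l : ℕ) = t then (if (y.1 : ℕ) = e then 1 else 0)
  else if (y.2 : ℕ) ≤ l then weightedHomogeneousComponent w 0 (U l) else 1

/-- A product over `range t` with exactly one non-unit slot. -/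
theorem prod_range_ite_eq_single {M : Type*} [CommMonoid M] (t m : ℕ) (hm : m < t) (f : ℕ → M) :
    ∏ n ∈ range t, (if n = m then f n else 1) = f m := by
  rw [Finset.prod_eq_single m]
  · rw [if_pos rfl]
  · intro n _ hn; rw [if_neg hn]
  · intro h; exact absurd (mem_range.mpr hm) h

/-- **The jump-matrix entry is the product of its factors.**
[cite: LimayeSrinivasanTavenas2025, Lemma 11] -/
theorem jumpMat_eq_prod_jumpFactor (w : σ → ℕ) (d t : ℕ) (U : ℕ → MvPolynomial σ R)
    (x y : Fin (d + 1) × Fin (t + 1)) :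
    jumpMat w d t U x y = ∏ l : Fin (t + 1), jumpFactor w d t U x y l := by
  rw [jumpMat_apply, Fin.prod_univ_castSucc]
  have hlast : jumpFactor w d t U x y (Fin.last t) =
      if (x.2 : ℕ) < y.2 ∧ (x.1 : ℕ) < y.1 then 1 else 0 := by
    simp only [jumpFactor, Fin.val_last, if_true]
  -- the factors below slot `t`, as a function of the layer number
  set g : ℕ → MvPolynomial σ R := fun n =>
    (if (x.2 : ℕ) ≤ n ∧ n + 1 < y.2 then weightedHomogeneousComponent w 0 (U n) else 1) *
      (if n = (y.2 : ℕ) - 1 ∧ 1 ≤ (y.2 : ℕ) then weightedHomogeneousComponent w ((y.1 : ℕ) - x.1) (U n)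
        else 1) with hg
  have hcast : ∀ l : Fin t, jumpFactor w d t U x y l.castSucc = g l := by
    intro l
    have hl : ((l.castSucc : Fin (t + 1)) : ℕ) = l := rfl
    simp only [jumpFactor, hl, hg]
    rw [if_neg (by omega)]
    by_cases h1 : (x.2 : ℕ) ≤ l ∧ (l : ℕ) + 1 < y.2
    · rw [if_pos h1, if_pos h1, if_neg (by omega), mul_one]
    · rw [if_neg h1, if_neg h1, one_mul]
      by_cases h2 : (l : ℕ) + 1 = y.2
      · rw [if_pos h2, if_pos (by omega)]
      · rw [if_neg h2, if_neg (by omega)]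
  rw [hlast, Fintype.prod_congr _ _ hcast, Fin.prod_univ_eq_prod_range g t]
  by_cases hv : (x.2 : ℕ) < y.2 ∧ (x.1 : ℕ) < y.1
  · rw [if_pos hv, if_pos hv, mul_one, hg, Finset.prod_mul_distrib]
    congr 1
    · rw [← Finset.prod_filter]
      refine Finset.prod_congr ?_ fun _ _ => rfl
      ext n
      simp only [mem_Ico, mem_filter, mem_range]
      have := y.2.isLt
      omega
    · have hy : 1 ≤ (y.2 : ℕ) := by omega
      have hc : ∀ n, (if n = (y.2 : ℕ) - 1 ∧ 1 ≤ (y.2 : ℕ) then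
          weightedHomogeneousComponent w ((y.1 : ℕ) - x.1) (U n) else 1) =
          (if n = (y.2 : ℕ) - 1 then weightedHomogeneousComponent w ((y.1 : ℕ) - x.1) (U n) else 1) := by
        intro n
        by_cases hn : n = (y.2 : ℕ) - 1
        · rw [if_pos ⟨hn, hy⟩, if_pos hn]
        · rw [if_neg (fun h => hn h.1), if_neg hn]
      simp_rw [hc]
      have := y.2.isLt
      exact (prod_range_ite_eq_single t ((y.2 : ℕ) - 1) (by omega)
        (fun n => weightedHomogeneousComponent w ((y.1 : ℕ) - x.1) (U n))).symm
  · rw [if_neg hv, if_neg hv, mul_zero]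

/-- The identity-layer entry is the product of its factors. -/
theorem one_apply_eq_prod_idFactor (d t : ℕ) (x y : Fin (d + 1) × Fin (t + 1)) :
    (1 : Matrix (Fin (d + 1) × Fin (t + 1)) (Fin (d + 1) × Fin (t + 1)) (MvPolynomial σ R)) x y =
      ∏ l : Fin (t + 1), idFactor d t x y l := by
  rw [Fin.prod_univ_castSucc]
  have hcast : ∀ l : Fin t, (idFactor d t x y l.castSucc : MvPolynomial σ R) = 1 := by
    intro l
    have hl : ((l.castSucc : Fin (t + 1)) : ℕ) = l := rfl
    simp only [idFactor, hl]
    rw [if_neg (by omega)]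
  rw [Fintype.prod_congr _ _ hcast, Finset.prod_const_one, one_mul]
  simp only [idFactor, Fin.val_last, if_true, Matrix.one_apply]

/-- Entries of the padded layers of the jump matrix as uniform products. -/
theorem padLayers_jumpMat_apply_eq_prod (w : σ → ℕ) (d t : ℕ) (U : ℕ → MvPolynomial σ R)
    (κ n : ℕ) (i : Fin n) (x y : Fin (d + 1) × Fin (t + 1)) :
    padLayers (jumpMat w d t U) κ n i x y =
      ∏ l : Fin (t + 1), (if (i : ℕ) < κ then jumpFactor w d t U x y l else idFactor d t x y l) := by
  unfold padLayers
  by_cases hi : (i : ℕ) < κ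
  · simp only [if_pos hi]; exact jumpMat_eq_prod_jumpFactor w d t U x y
  · simp only [if_neg hi]; exact one_apply_eq_prod_idFactor d t x y

/-- The terminal-vector entry is the product of its factors. -/
theorem finVec_eq_prod_finFactor (w : σ → ℕ) (d t e : ℕ) (U : ℕ → MvPolynomial σ R)
    (y : Fin (d + 1) × Fin (t + 1)) :
    finVec w d t e U y = ∏ l : Fin (t + 1), finFactor w d t e U y l := by
  rw [Fin.prod_univ_castSucc]
  have hlast : finFactor w d t e U y (Fin.last t) = if (y.1 : ℕ) = e then 1 else 0 := by
    simp only [finFactor, Fin.val_last, if_true]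
  set g : ℕ → MvPolynomial σ R := fun n =>
    if (y.2 : ℕ) ≤ n then weightedHomogeneousComponent w 0 (U n) else 1 with hg
  have hcast : ∀ l : Fin t, finFactor w d t e U y l.castSucc = g l := by
    intro l
    have hl : ((l.castSucc : Fin (t + 1)) : ℕ) = l := rfl
    simp only [finFactor, hl, hg]
    rw [if_neg (by omega)]
  rw [hlast, Fintype.prod_congr _ _ hcast, Fin.prod_univ_eq_prod_range g t]
  unfold finVec
  by_cases hy : (y.1 : ℕ) = e
  · rw [if_pos hy, if_pos hy, mul_one, hg, ← Finset.prod_filter]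
    refine Finset.prod_congr ?_ fun _ _ => rfl
    ext n
    simp only [mem_Ico, mem_filter, mem_range]
    omega
  · rw [if_neg hy, if_neg hy, mul_zero]

/-! ### Homogeneity of the factors -/

/-- The weight of jump factor `l`: `y₁ - x₁` in the jump slot, `0` elsewhere (same case split as
`jumpFactor`). -/
def jumpFactorWt (d t : ℕ) (x y : Fin (d + 1) × Fin (t + 1)) (l : Fin (t + 1)) : ℕ :=
  if (l : ℕ) = t then 0
  else if (x.2 : ℕ) ≤ l ∧ (l : ℕ) + 1 < y.2 then 0
  else if (l : ℕ) + 1 = y.2 then (y.1 : ℕ) - x.1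
  else 0

/-- Every jump factor is weighted homogeneous, of weight `jumpFactorWt`. -/
theorem jumpFactor_isWeightedHomogeneous (w : σ → ℕ) (d t : ℕ) (U : ℕ → MvPolynomial σ R)
    (x y : Fin (d + 1) × Fin (t + 1)) (l : Fin (t + 1)) :
    IsWeightedHomogeneous w (jumpFactor w d t U x y l) (jumpFactorWt d t x y l) := by
  unfold jumpFactor jumpFactorWt
  by_cases h0 : (l : ℕ) = t
  · simp only [if_pos h0]
    by_cases hv : (x.2 : ℕ) < y.2 ∧ (x.1 : ℕ) < y.1
    · rw [if_pos hv]; exact isWeightedHomogeneous_one R w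
    · rw [if_neg hv]; exact isWeightedHomogeneous_zero R w 0
  · simp only [if_neg h0]
    by_cases h1 : (x.2 : ℕ) ≤ l ∧ (l : ℕ) + 1 < y.2
    · simp only [if_pos h1]
      exact weightedHomogeneousComponent_isWeightedHomogeneous 0 _
    · simp only [if_neg h1]
      by_cases h2 : (l : ℕ) + 1 = y.2
      · simp only [if_pos h2]
        exact weightedHomogeneousComponent_isWeightedHomogeneous _ _
      · simp only [if_neg h2]
        exact isWeightedHomogeneous_one R w

/-- Every identity factor is weighted homogeneous of weight `0`. -/
theorem idFactor_isWeightedHomogeneous (w : σ → ℕ) (d t : ℕ) (x y : Fin (d + 1) × Fin (t + 1))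
    (l : Fin (t + 1)) : IsWeightedHomogeneous w (idFactor d t x y l : MvPolynomial σ R) 0 := by
  unfold idFactor
  by_cases h0 : (l : ℕ) = t
  · rw [if_pos h0]
    by_cases hxy : x = y
    · rw [if_pos hxy]; exact isWeightedHomogeneous_one R w
    · rw [if_neg hxy]; exact isWeightedHomogeneous_zero R w 0
  · rw [if_neg h0]; exact isWeightedHomogeneous_one R w

/-- Every terminal factor is weighted homogeneous of weight `0`. -/
theorem finFactor_isWeightedHomogeneous (w : σ → ℕ) (d t e : ℕ) (U : ℕ → MvPolynomial σ R)
    (y : Fin (d + 1) × Fin (t + 1)) (l : Fin (t + 1)) :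
    IsWeightedHomogeneous w (finFactor w d t e U y l) 0 := by
  unfold finFactor
  by_cases h0 : (l : ℕ) = t
  · rw [if_pos h0]
    by_cases hy : (y.1 : ℕ) = e
    · rw [if_pos hy]; exact isWeightedHomogeneous_one R w
    · rw [if_neg hy]; exact isWeightedHomogeneous_zero R w 0
  · rw [if_neg h0]
    by_cases h1 : (y.2 : ℕ) ≤ l
    · rw [if_pos h1]; exact weightedHomogeneousComponent_isWeightedHomogeneous 0 _
    · rw [if_neg h1]; exact isWeightedHomogeneous_one R w

end Summit.ValiantsHypothesis.ValiantsHypothesis.Theorems.DepthWindow
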